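import Literature.Analysis.DeBrangesSpaces.HardyPaleyWiener
import Literature.NumberTheory.LFunctions.BurnolZetaSystemsHardy
import Literature.Analysis.Complex.HolomorphicParametricIntegral
import HarnessLib

/-!
# Paley–Wiener in Mellin coordinates: `H²(Re s > ½)` is the right Mellin transform of `L²(1, ∞)`

LINE 1 — LABEL: RH-FREE (folklore analysis: the Paley–Wiener theorem for the Hardy space of a
half-plane, moved from the upper half-plane / Fourier–Laplace picture to the half-plane `Re s > ½` /
Mellin picture by the change of variables `t = eˣ`, `s = ½ − iw`). bears_on: B-C/B-P (COLUMN 6 DBR) as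
infrastructure only (the Burnol 2004b §4 discharges `Burnol2004b_prop4_1R (ii)`, `prop4_2`, `prop4_3`,
`lemma4_4`, `prop4_5` all PRODUCE an `L²` function from `H²`-membership through this file). WHAT THIS
IS NOT: nothing in this file is a statement about `ζ`, its zeros, or RH; nothing here bears on the
truth of RH.

Topic `NumberTheory/LFunctions` (support file for `BurnolZetaSystemsHardy.lean`: theorems only, no
definitions, no named facts). Burnol [Burnol2004b, §4, TeX l.633–638]: "The right Mellin transform is
an isometric identification of `L²(1,∞; dt)` with `ℍ²`: this is one of the famous theorems of
Paley-Wiener, after a change of variable. Hence, for `0 < a` and `A = 1/a`, the right Mellin transform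
is an isometric identification of `L²(a,∞; dt)` with `A^s ℍ²`." Here `ℍ² = H²(Re s > ½)` in the
ANALYTIC picture is the tree's `IsHardyRight` (holomorphic on the open half-plane, uniformly bounded
`L²` norms on vertical lines), and the general Paley–Wiener theorem for `H²(ℂ₊)` with a.e. boundary
values is the tree's `Literature.Analysis.DeBrangesSpaces.exists_halfLine_laplace_of_hardy`
[Rudin1987, Thm. 19.2]. Both halves of the identification are proved.

Membership ⇒ representation (the direction USED in §4 to PRODUCE an `L²` function):
* `exists_rightMellin_eq_of_hardyRight` — if `F` is holomorphic on `{Re s > ½}` with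
  `∫‖F(σ+iτ)‖²dτ ≤ M²` for all `σ > ½`, there is a measurable `φ : ℝ → ℂ`, vanishing on `(−∞, 1]`,
  square-integrable with `2π∫‖φ‖² ≤ M²`, whose right Mellin transform `φ̂(s) = ∫₀^∞ φ(t)t^{−s}dt`
  converges absolutely and equals `F(s)` at every `s` with `Re s > ½`;
* `IsHardyRight.exists_rightMellin_eq` — the same from the hypothesis `IsHardyRight F`;
* `IsHardyRight.exists_rightMellin_eq_Ioi` — the scaled form: `IsHardyRight (s ↦ a^s K(s))`, `a > 0`,
  gives `φ` vanishing on `(−∞, a]` with `φ̂ = K` on `Re s > ½` ("`L²(a,∞) ≅ A^s ℍ²`, `A = 1/a`").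

Representation ⇒ membership, isometry and uniqueness (for `φ ∈ L²(ℝ)` vanishing a.e. on `(−∞,1]`):
* `mellinConvergent_one_sub_of_memLp`, `differentiableOn_rightMellin_of_memLp` — `φ̂(s)` converges
  absolutely and is holomorphic on `{Re s > ½}` (dominated holomorphic parameter integral);
* `integral_norm_sq_rightMellin_eq` / `_le` — Mellin–Plancherel on vertical lines,
  `∫‖φ̂(σ+iτ)‖²dτ = 2π∫₀^∞‖φ(t)‖²t^{1−2σ}dt ≤ 2π∫‖φ‖²` (`σ > ½`);
* `isHardyRight_rightMellin_of_memLp` — hence `φ̂ ∈ ℍ²`; `isHardyRight_cpow_mul_rightMellin_of_memLp`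
  — the scaled form `L²(a,∞) → A^s ℍ²` (`φ` vanishing a.e. on `(−∞,a]`, `a > 0`);
* `ae_eq_of_rightMellin_eq` — `φ` is determined a.e. by `φ̂` on `{Re s > ½}`.

See also `Burnol2004bHardyStrip.isHardyRight_cpow_mul_mellin` (`BurnolSonineHardyStrip.lean`, landed
the same hour) for the membership half `L²(a,∞) → A^s ℍ²` with pointwise-vanishing hypotheses and the
`mellin k (1 − s)` spelling; the two statements are interchangeable.

Dictionary (proof of the first item): with `G(w) := F(½ − iw)` one has `Re(½ − iw) = ½ + Im w` and
`∫‖G(x+iy)‖²dx = ∫‖F(½+y+iτ)‖²dτ`, so `G ∈ H²(ℂ₊)`; Paley–Wiener gives `ψ ∈ L²(0,∞)` with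
`G(w) = ∫₀^∞ ψ(x)e^{iwx}dx`; put `φ(t) := ψ(log t)·t^{−1/2}` for `t > 1` (zero otherwise). Then for
`Re s > ½`, with `w = i(s − ½)` (so `½ − iw = s`, `e^{iwx} = e^{(½−s)x}`), the substitution `t = eˣ`
gives `φ̂(s) = ∫₀^∞ ψ(x)e^{−x/2}e^{(1−s)x}dx = G(w) = F(s)` and `∫₁^∞‖φ‖² = ∫₀^∞‖ψ‖²`. The converse
half uses the tree's Mellin–Plancherel theorem `Literature.Analysis.FunctionSpaces.integral_norm_sq_mellin_eq`
(Titchmarsh, *Fourier integrals*, Thm. 71) and `Literature.Analysis.Complex.differentiableOn_integral_of_dominated`.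

## References

* J.-F. Burnol, *On Fourier and zeta(s)*, Forum Math. 16 (2004) = arXiv:math/0203120v7, §4
  (TeX l.626–643). [key `Burnol2004b`]
* W. Rudin, *Real and complex analysis*, 3rd ed. (1987), Thm. 19.2. [key `Rudin1987`]
* R. E. A. C. Paley, N. Wiener, *Fourier transforms in the complex domain*, AMS Colloq. Publ. 19
  (1934) (the original theorem; cited through Rudin).
-/

noncomputable section

open Complex Filter Topology Set MeasureTheory
open scoped Real

namespace Literature.NumberTheory.LFunctions

namespace HardyRightPW

/-! ### The substitution `t = eˣ` -/

/-- `(eˣ)^z = e^{xz}` (principal power of a positive real). [folklore] -/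
private theorem ofReal_exp_cpow (x : ℝ) (z : ℂ) : ((Real.exp x : ℝ) : ℂ) ^ z = cexp (x * z) := by
  rw [cpow_def_of_ne_zero (ofReal_ne_zero.2 (Real.exp_pos x).ne'), ← ofReal_log (Real.exp_pos x).le,
    Real.log_exp]

/-- `(a⁻¹)^z = a^{−z}` for a positive real `a` (principal powers). [folklore] -/
private theorem inv_ofReal_cpow {a : ℝ} (ha : 0 < a) (z : ℂ) :
    ((a⁻¹ : ℝ) : ℂ) ^ z = (a : ℂ) ^ (-z) := by
  rw [cpow_def_of_ne_zero (ofReal_ne_zero.2 (inv_pos.2 ha).ne'),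
    cpow_def_of_ne_zero (ofReal_ne_zero.2 ha.ne'), ← ofReal_log (inv_pos.2 ha).le,
    ← ofReal_log ha.le, Real.log_inv]
  congr 1
  push_cast
  ring

/-- `∫₀^∞ g(t) dt = ∫_ℝ eˣ g(eˣ) dx` (both sides junk `0` together when divergent). [folklore] -/
private theorem setIntegral_Ioi_eq_integral_comp_exp {E : Type*} [NormedAddCommGroup E]
    [NormedSpace ℝ E] (g : ℝ → E) :
    ∫ t in Ioi (0 : ℝ), g t = ∫ x : ℝ, Real.exp x • g (Real.exp x) := by
  have himg : Real.exp '' univ = Ioi 0 := by rw [image_univ, Real.range_exp]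
  have hderiv : ∀ x ∈ (univ : Set ℝ), HasDerivWithinAt Real.exp (Real.exp x) univ x :=
    fun x _ ↦ (Real.hasDerivAt_exp x).hasDerivWithinAt
  rw [← himg, integral_image_eq_integral_abs_deriv_smul MeasurableSet.univ hderiv
    Real.exp_injective.injOn, setIntegral_univ]
  refine integral_congr_ae (ae_of_all _ fun x ↦ ?_)
  simp only [abs_of_pos (Real.exp_pos x)]

/-- `g` is integrable on `(0,∞)` iff `x ↦ eˣ g(eˣ)` is integrable on `ℝ`. [folklore] -/
private theorem integrableOn_Ioi_iff_integrable_comp_exp {E : Type*} [NormedAddCommGroup E]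
    [NormedSpace ℝ E] (g : ℝ → E) :
    IntegrableOn g (Ioi (0 : ℝ)) ↔ Integrable (fun x : ℝ ↦ Real.exp x • g (Real.exp x)) := by
  have himg : Real.exp '' univ = Ioi 0 := by rw [image_univ, Real.range_exp]
  have hderiv : ∀ x ∈ (univ : Set ℝ), HasDerivWithinAt Real.exp (Real.exp x) univ x :=
    fun x _ ↦ (Real.hasDerivAt_exp x).hasDerivWithinAt
  rw [← himg, integrableOn_image_iff_integrableOn_abs_deriv_smul MeasurableSet.univ hderiv
    Real.exp_injective.injOn, integrableOn_univ]
  refine integrable_congr (ae_of_all _ fun x ↦ ?_)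
  simp only [abs_of_pos (Real.exp_pos x)]

/-! ### The pull-back `φ(t) = ψ(log t) t^{−1/2}` (`t > 1`) of a function `ψ` on `(0, ∞)` -/

/-- The pull-back evaluated at `t = eˣ`. [folklore] -/
private theorem pull_exp (ψ : ℝ → ℂ) (x : ℝ) :
    (Ioi (1 : ℝ)).indicator (fun t : ℝ ↦ ψ (Real.log t) * ((Real.exp (-(Real.log t) / 2) : ℝ) : ℂ))
      (Real.exp x) = (Ioi (0 : ℝ)).indicator (fun x : ℝ ↦ ψ x * ((Real.exp (-x / 2) : ℝ) : ℂ)) x := by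
  by_cases hx : 0 < x
  · have h1 : Real.exp x ∈ Ioi (1 : ℝ) := by simpa using hx
    rw [indicator_of_mem h1, indicator_of_mem (show x ∈ Ioi (0 : ℝ) from hx), Real.log_exp]
  · have h1 : Real.exp x ∉ Ioi (1 : ℝ) := by simpa using hx
    rw [indicator_of_notMem h1, indicator_of_notMem (show x ∉ Ioi (0 : ℝ) from hx)]

/-- The pull-back is measurable when `ψ` is. [folklore] -/
private theorem measurable_pull {ψ : ℝ → ℂ} (hψ : Measurable ψ) :
    Measurable ((Ioi (1 : ℝ)).indicator
      (fun t : ℝ ↦ ψ (Real.log t) * ((Real.exp (-(Real.log t) / 2) : ℝ) : ℂ))) := by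
  refine Measurable.indicator ?_ measurableSet_Ioi
  exact (hψ.comp Real.measurable_log).mul (Complex.measurable_ofReal.comp (by fun_prop))

/-- The pull-back vanishes on `(−∞, 1]`. [folklore] -/
private theorem pull_eq_zero (ψ : ℝ → ℂ) {t : ℝ} (ht : t ≤ 1) :
    (Ioi (1 : ℝ)).indicator
      (fun t : ℝ ↦ ψ (Real.log t) * ((Real.exp (-(Real.log t) / 2) : ℝ) : ℂ)) t = 0 :=
  indicator_of_notMem (by simpa using ht) _

/-- The Mellin integrand of the pull-back at `1 − s`, pulled back to `x = log t`, is
`1_{(0,∞)}(x) ψ(x) e^{iwx}` with `w = i(s − ½)`. [folklore] -/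
private theorem mellin_integrand_pull (ψ : ℝ → ℂ) (s : ℂ) (x : ℝ) :
    Real.exp x • ((((Real.exp x : ℝ) : ℂ) ^ ((1 - s) - 1)) •
      (Ioi (1 : ℝ)).indicator
        (fun t : ℝ ↦ ψ (Real.log t) * ((Real.exp (-(Real.log t) / 2) : ℝ) : ℂ)) (Real.exp x)) =
      (Ioi (0 : ℝ)).indicator (fun x : ℝ ↦ ψ x * cexp (I * (I * (s - 1 / 2)) * x)) x := by
  rw [pull_exp]
  by_cases hx : x ∈ Ioi (0 : ℝ)
  · rw [indicator_of_mem hx, indicator_of_mem hx, ofReal_exp_cpow, smul_eq_mul, Complex.real_smul,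
      Complex.ofReal_exp, Complex.ofReal_exp]
    have hI : I * (I * (s - 1 / 2)) * (x : ℂ) = (x : ℂ) + (x : ℂ) * (1 - s - 1) + ↑(-x / 2 : ℝ) := by
      rw [← mul_assoc, I_mul_I]; push_cast; ring
    rw [hI, Complex.exp_add, Complex.exp_add]
    ring
  · rw [indicator_of_notMem hx, indicator_of_notMem hx, smul_zero, smul_zero]

/-- The squared norm of the pull-back, pulled back to `x = log t`, is `1_{(0,∞)}(x)‖ψ(x)‖²`. [folklore] -/
private theorem norm_sq_integrand_pull (ψ : ℝ → ℂ) (x : ℝ) :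
    Real.exp x • ‖(Ioi (1 : ℝ)).indicator
        (fun t : ℝ ↦ ψ (Real.log t) * ((Real.exp (-(Real.log t) / 2) : ℝ) : ℂ)) (Real.exp x)‖ ^ 2 =
      (Ioi (0 : ℝ)).indicator (fun x : ℝ ↦ ‖ψ x‖ ^ 2) x := by
  rw [pull_exp]
  by_cases hx : x ∈ Ioi (0 : ℝ)
  · rw [indicator_of_mem hx, indicator_of_mem hx, norm_mul, Complex.norm_real, Real.norm_eq_abs,
      abs_of_pos (Real.exp_pos _), mul_pow, smul_eq_mul, ← Real.exp_nat_mul]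
    have : Real.exp x * Real.exp ((2 : ℕ) * (-x / 2)) = 1 := by
      rw [← Real.exp_add]; push_cast; ring_nf; exact Real.exp_zero
    calc Real.exp x * (‖ψ x‖ ^ 2 * Real.exp ((2 : ℕ) * (-x / 2)))
        = ‖ψ x‖ ^ 2 * (Real.exp x * Real.exp ((2 : ℕ) * (-x / 2))) := by ring
      _ = ‖ψ x‖ ^ 2 := by rw [this, mul_one]
  · rw [indicator_of_notMem hx, indicator_of_notMem hx, norm_zero, zero_pow two_ne_zero, smul_zero]

/-- The pull-back of `ψ ∈ L²` is square-integrable with `∫‖φ‖² = ∫₀^∞‖ψ‖²`. [folklore] -/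
private theorem integrable_norm_sq_pull {ψ : ℝ → ℂ} (hψ : MemLp ψ 2 volume) :
    Integrable (fun t : ℝ ↦ ‖(Ioi (1 : ℝ)).indicator
        (fun t : ℝ ↦ ψ (Real.log t) * ((Real.exp (-(Real.log t) / 2) : ℝ) : ℂ)) t‖ ^ 2) ∧
      ∫ t : ℝ, ‖(Ioi (1 : ℝ)).indicator
        (fun t : ℝ ↦ ψ (Real.log t) * ((Real.exp (-(Real.log t) / 2) : ℝ) : ℂ)) t‖ ^ 2 =
        ∫ x in Ioi (0 : ℝ), ‖ψ x‖ ^ 2 := by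
  set φ : ℝ → ℂ := (Ioi (1 : ℝ)).indicator
    (fun t : ℝ ↦ ψ (Real.log t) * ((Real.exp (-(Real.log t) / 2) : ℝ) : ℂ)) with hφ
  have hψ2 : Integrable (fun x : ℝ ↦ ‖ψ x‖ ^ 2) := (memLp_two_iff_integrable_sq_norm hψ.1).1 hψ
  -- `‖φ‖²` vanishes off `(0,∞)`, so it is its own indicator there
  have hind : (fun t : ℝ ↦ ‖φ t‖ ^ 2) = (Ioi (0 : ℝ)).indicator (fun t : ℝ ↦ ‖φ t‖ ^ 2) := by
    funext t
    by_cases ht : t ∈ Ioi (0 : ℝ)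
    · rw [indicator_of_mem ht]
    · rw [indicator_of_notMem ht, hφ, pull_eq_zero ψ (le_trans (not_lt.1 ht) zero_le_one), norm_zero,
        zero_pow two_ne_zero]
  have hcomp : (fun x : ℝ ↦ Real.exp x • (fun t : ℝ ↦ ‖φ t‖ ^ 2) (Real.exp x)) =
      (Ioi (0 : ℝ)).indicator (fun x : ℝ ↦ ‖ψ x‖ ^ 2) := by
    funext x; exact norm_sq_integrand_pull ψ x
  have hIoi : IntegrableOn (fun t : ℝ ↦ ‖φ t‖ ^ 2) (Ioi 0) := by
    rw [integrableOn_Ioi_iff_integrable_comp_exp, hcomp]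
    exact hψ2.indicator measurableSet_Ioi
  refine ⟨?_, ?_⟩
  · rw [hind]; exact hIoi.integrable_indicator measurableSet_Ioi
  · rw [hind, integral_indicator measurableSet_Ioi, setIntegral_Ioi_eq_integral_comp_exp, hcomp,
      integral_indicator measurableSet_Ioi]

/-- Mellin convergence and the value of the right Mellin transform of the pull-back at `s`, in terms
of the half-line Fourier–Laplace transform of `ψ` at `w = i(s − ½)`. [folklore] -/
private theorem rightMellin_pull {ψ : ℝ → ℂ} (hψ : MemLp ψ 2 volume) {s : ℂ} (hs : 1 / 2 < s.re) :
    MellinConvergent ((Ioi (1 : ℝ)).indicator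
        (fun t : ℝ ↦ ψ (Real.log t) * ((Real.exp (-(Real.log t) / 2) : ℝ) : ℂ))) (1 - s) ∧
      rightMellin ((Ioi (1 : ℝ)).indicator
        (fun t : ℝ ↦ ψ (Real.log t) * ((Real.exp (-(Real.log t) / 2) : ℝ) : ℂ))) s =
        ∫ x in Ioi (0 : ℝ), ψ x * cexp (I * (I * (s - 1 / 2)) * x) := by
  set φ : ℝ → ℂ := (Ioi (1 : ℝ)).indicator
    (fun t : ℝ ↦ ψ (Real.log t) * ((Real.exp (-(Real.log t) / 2) : ℝ) : ℂ)) with hφ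
  have hw : 0 < (I * (s - 1 / 2)).im := by
    simp only [mul_im, I_re, I_im, sub_re, one_mul, zero_mul, zero_add]
    norm_num; linarith
  have hint := Literature.Analysis.DeBrangesSpaces.integrableOn_mul_cexp_Ioi_of_memLp hψ hw
  have hcomp : (fun x : ℝ ↦ Real.exp x • (fun t : ℝ ↦ ((t : ℂ) ^ ((1 - s) - 1)) • φ t) (Real.exp x)) =
      (Ioi (0 : ℝ)).indicator (fun x : ℝ ↦ ψ x * cexp (I * (I * (s - 1 / 2)) * x)) := by
    funext x; exact mellin_integrand_pull ψ s x
  refine ⟨?_, ?_⟩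
  · show IntegrableOn (fun t : ℝ ↦ ((t : ℂ) ^ ((1 - s) - 1)) • φ t) (Ioi 0)
    rw [integrableOn_Ioi_iff_integrable_comp_exp, hcomp]
    exact hint.integrable_indicator measurableSet_Ioi
  · show mellin φ (1 - s) = _
    rw [mellin, setIntegral_Ioi_eq_integral_comp_exp, hcomp, integral_indicator measurableSet_Ioi]

end HardyRightPW

open HardyRightPW in
/-- RH-FREE. **Paley–Wiener in Mellin coordinates** ("the right Mellin transform is an isometric
identification of `L²(1,∞;dt)` with `ℍ²` … one of the famous theorems of Paley-Wiener, after a change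
of variable"), the direction membership ⇒ representation, quantitative form: if `F` is holomorphic on
the open half-plane `{Re s > ½}` and `∫_ℝ ‖F(σ + iτ)‖² dτ ≤ M²` for every `σ > ½` (vertical lines
square-integrable), then there is a measurable `φ : ℝ → ℂ` vanishing on `(−∞, 1]`, square-integrable
with `2π ∫‖φ‖² ≤ M²`, such that for every `s` with `Re s > ½` the right Mellin transform
`φ̂(s) = ∫₀^∞ φ(t) t^{−s} dt` converges absolutely and equals `F(s)`.
[cite: Burnol2004b, §4 (arXiv:math/0203120v7 p. 7, TeX l.633–636); Rudin1987, Thm. 19.2] -/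
theorem exists_rightMellin_eq_of_hardyRight {F : ℂ → ℂ} {M : ℝ}
    (hd : DifferentiableOn ℂ F {s : ℂ | 1 / 2 < s.re})
    (h2 : ∀ σ : ℝ, 1 / 2 < σ → MemLp (fun τ : ℝ ↦ F (σ + τ * I)) 2 volume)
    (hM : ∀ σ : ℝ, 1 / 2 < σ → ∫ τ : ℝ, ‖F (σ + τ * I)‖ ^ 2 ≤ M ^ 2) (hM0 : 0 ≤ M) :
    ∃ φ : ℝ → ℂ, Measurable φ ∧ (∀ t : ℝ, t ≤ 1 → φ t = 0) ∧ MemLp φ 2 volume ∧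
      2 * π * ∫ t : ℝ, ‖φ t‖ ^ 2 ≤ M ^ 2 ∧
      ∀ s : ℂ, 1 / 2 < s.re → MellinConvergent φ (1 - s) ∧ rightMellin φ s = F s := by
  -- the `H²(ℂ₊)` function `G(w) = F(½ − iw)`
  set G : ℂ → ℂ := fun w ↦ F (1 / 2 - I * w) with hG
  have hline : ∀ x y : ℝ, (1 : ℂ) / 2 - I * ((x : ℂ) + (y : ℂ) * I) =
      (((1 / 2 + y : ℝ) : ℂ)) + ((-x : ℝ) : ℂ) * I := by
    intro x y
    have hII : I * ((x : ℂ) + (y : ℂ) * I) = - (y : ℂ) + (x : ℂ) * I := by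
      rw [mul_add, ← mul_assoc, mul_comm I (y : ℂ), mul_assoc, I_mul_I]; ring
    rw [hII]; push_cast; ring
  have hGd : DifferentiableOn ℂ G {w : ℂ | 0 < w.im} := by
    have hmap : MapsTo (fun w : ℂ ↦ 1 / 2 - I * w) {w : ℂ | 0 < w.im} {s : ℂ | 1 / 2 < s.re} := by
      intro w hw
      simp only [mem_setOf_eq] at hw ⊢
      simp only [sub_re, mul_re, I_re, I_im, zero_mul, one_mul, zero_sub]
      norm_num; linarith
    exact hd.comp (by fun_prop) hmap
  have hGline : ∀ y : ℝ, 0 < y → (fun x : ℝ ↦ ‖G (x + y * I)‖ ^ 2) =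
      fun x : ℝ ↦ (fun τ : ℝ ↦ ‖F (((1 / 2 + y : ℝ) : ℂ) + τ * I)‖ ^ 2) (-x) := by
    intro y _; funext x; simp only [hG, hline]
  have hG2 : ∀ y : ℝ, 0 < y → Integrable (fun x : ℝ ↦ ‖G (x + y * I)‖ ^ 2) := by
    intro y hy
    rw [hGline y hy]
    have hy' : (1 : ℝ) / 2 < 1 / 2 + y := by linarith
    exact ((memLp_two_iff_integrable_sq_norm (h2 _ hy').1).1 (h2 _ hy')).comp_neg
  have hGM : ∀ y : ℝ, 0 < y → ∫ x : ℝ, ‖G (x + y * I)‖ ^ 2 ≤ M ^ 2 := by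
    intro y hy
    rw [hGline y hy]
    have hneg := integral_neg_eq_self
      (fun τ : ℝ ↦ ‖F (((1 / 2 + y : ℝ) : ℂ) + τ * I)‖ ^ 2) (volume : Measure ℝ)
    refine le_trans (le_of_eq ?_) (hM (1 / 2 + y) (by linarith))
    exact hneg
  -- Paley–Wiener for `G`
  obtain ⟨ψ₀, hψ₀, -, hψ₀M, hψ₀G⟩ :=
    Literature.Analysis.DeBrangesSpaces.exists_halfLine_laplace_of_hardy hGd hG2 hGM hM0
  -- a measurable modification `ψ` of `ψ₀`
  set ψ : ℝ → ℂ := hψ₀.1.mk ψ₀ with hψdef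
  have hψψ₀ : ψ₀ =ᵐ[volume] ψ := hψ₀.1.ae_eq_mk
  have hψm : Measurable ψ := hψ₀.1.stronglyMeasurable_mk.measurable
  have hψ : MemLp ψ 2 volume := hψ₀.ae_eq hψψ₀
  have hψM : 2 * π * ∫ x : ℝ, ‖ψ x‖ ^ 2 ≤ M ^ 2 := by
    have : ∫ x : ℝ, ‖ψ x‖ ^ 2 = ∫ x : ℝ, ‖ψ₀ x‖ ^ 2 :=
      integral_congr_ae (hψψ₀.symm.mono fun x hx ↦ by simp only [hx])
    rw [this]; exact hψ₀M
  have hψG : ∀ w : ℂ, 0 < w.im → ∫ x in Ioi (0 : ℝ), ψ x * cexp (I * w * x) = G w := by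
    intro w hw
    rw [← hψ₀G w hw]
    exact integral_congr_ae ((ae_restrict_of_ae hψψ₀).mono fun x hx ↦ by simp only [hx])
  -- the pull-back `φ`
  refine ⟨(Ioi (1 : ℝ)).indicator
      (fun t : ℝ ↦ ψ (Real.log t) * ((Real.exp (-(Real.log t) / 2) : ℝ) : ℂ)),
    measurable_pull hψm, fun t ht ↦ pull_eq_zero ψ ht, ?_, ?_, fun s hs ↦ ?_⟩
  · exact (memLp_two_iff_integrable_sq_norm (measurable_pull hψm).aestronglyMeasurable).2
      (integrable_norm_sq_pull hψ).1
  · rw [(integrable_norm_sq_pull hψ).2]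
    refine le_trans ?_ hψM
    have hψ2 : Integrable (fun x : ℝ ↦ ‖ψ x‖ ^ 2) := (memLp_two_iff_integrable_sq_norm hψ.1).1 hψ
    exact mul_le_mul_of_nonneg_left
      (setIntegral_le_integral hψ2 (ae_of_all _ fun x ↦ by positivity)) (by positivity)
  · refine ⟨(rightMellin_pull hψ hs).1, ?_⟩
    rw [(rightMellin_pull hψ hs).2, hψG _ (by
      simp only [mul_im, I_re, I_im, sub_re, one_mul, zero_mul, zero_add]; norm_num; linarith)]
    simp only [hG]
    congr 1
    rw [← mul_assoc, I_mul_I]; ring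

/-- RH-FREE. **Paley–Wiener in Mellin coordinates** for the tree's `IsHardyRight` (`ℍ² = H²(Re s > ½)`
in the analytic picture): every `F ∈ ℍ²` is the right Mellin transform `F(s) = ∫₁^∞ φ(t) t^{−s} dt`
(`Re s > ½`, absolutely convergent) of a measurable square-integrable `φ` vanishing on `(−∞, 1]`
— "the right Mellin transform is an isometric identification of `L²(1,∞;dt)` with `ℍ²`", the
surjectivity half. [cite: Burnol2004b, §4 (arXiv:math/0203120v7 p. 7, TeX l.633–636); Rudin1987, Thm. 19.2] -/
theorem IsHardyRight.exists_rightMellin_eq {F : ℂ → ℂ} (hF : IsHardyRight F) :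
    ∃ φ : ℝ → ℂ, Measurable φ ∧ (∀ t : ℝ, t ≤ 1 → φ t = 0) ∧ MemLp φ 2 volume ∧
      ∀ s : ℂ, 1 / 2 < s.re → MellinConvergent φ (1 - s) ∧ rightMellin φ s = F s := by
  obtain ⟨hd, C, hC⟩ := hF
  have hC0 : 0 ≤ C := le_trans (integral_nonneg fun τ ↦ by positivity) (hC 1 (by norm_num)).2
  obtain ⟨φ, hφm, hφ0, hφ2, -, hφF⟩ := exists_rightMellin_eq_of_hardyRight (M := Real.sqrt C) hd
    (fun σ hσ ↦ (hC σ hσ).1) (fun σ hσ ↦ by rw [Real.sq_sqrt hC0]; exact (hC σ hσ).2)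
    (Real.sqrt_nonneg C)
  exact ⟨φ, hφm, hφ0, hφ2, hφF⟩

open HardyRightPW in
/-- RH-FREE. **The scaled form `L²(a,∞; dt) ≅ A^s ℍ²`, `A = 1/a`** (surjectivity half): if `a > 0` and
`s ↦ a^s K(s)` lies in `ℍ² = H²(Re s > ½)` (`IsHardyRight`), then `K(s) = ∫ₐ^∞ φ(t) t^{−s} dt` on
`Re s > ½` (absolutely convergent) for a measurable square-integrable `φ` vanishing on `(−∞, a]`
(`φ(t) = a⁻¹ φ₁(t/a)` with `φ₁` from `IsHardyRight.exists_rightMellin_eq`).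
[cite: Burnol2004b, §4 (arXiv:math/0203120v7 p. 7, TeX l.636–638)] -/
theorem IsHardyRight.exists_rightMellin_eq_Ioi {K : ℂ → ℂ} {a : ℝ} (ha : 0 < a)
    (hK : IsHardyRight (fun s ↦ (a : ℂ) ^ s * K s)) :
    ∃ φ : ℝ → ℂ, Measurable φ ∧ (∀ t : ℝ, t ≤ a → φ t = 0) ∧ MemLp φ 2 volume ∧
      ∀ s : ℂ, 1 / 2 < s.re → MellinConvergent φ (1 - s) ∧ rightMellin φ s = K s := by
  obtain ⟨φ₁, hφ₁m, hφ₁0, hφ₁2, hφ₁F⟩ := hK.exists_rightMellin_eq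
  have ha0 : (a : ℂ) ≠ 0 := ofReal_ne_zero.2 ha.ne'
  have hai : 0 < a⁻¹ := inv_pos.2 ha
  refine ⟨fun t ↦ ((a⁻¹ : ℝ) : ℂ) * φ₁ (a⁻¹ * t), ?_, fun t ht ↦ ?_, ?_, fun s hs ↦ ⟨?_, ?_⟩⟩
  · exact (hφ₁m.comp (measurable_const_mul a⁻¹)).const_mul _
  · simp only
    rw [hφ₁0 _ (by rwa [inv_mul_le_iff₀ ha, mul_one]), mul_zero]
  · have h1 : MemLp (fun t : ℝ ↦ φ₁ (a⁻¹ * t)) 2 volume := by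
      refine (memLp_two_iff_integrable_sq_norm
        (hφ₁m.comp (measurable_const_mul a⁻¹)).aestronglyMeasurable).2 ?_
      exact (((memLp_two_iff_integrable_sq_norm hφ₁2.1).1 hφ₁2).comp_mul_left' hai.ne' :)
    exact h1.const_mul _
  · show MellinConvergent (fun t ↦ ((a⁻¹ : ℝ) : ℂ) • φ₁ (a⁻¹ * t)) (1 - s)
    exact ((MellinConvergent.comp_mul_left hai).2 (hφ₁F s hs).1).const_smul _
  · show mellin (fun t ↦ ((a⁻¹ : ℝ) : ℂ) • φ₁ (a⁻¹ * t)) (1 - s) = K s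
    have hmel : mellin φ₁ (1 - s) = (a : ℂ) ^ s * K s := (hφ₁F s hs).2
    rw [mellin_const_smul, mellin_comp_mul_left _ _ hai, hmel, inv_ofReal_cpow ha, neg_neg,
      smul_eq_mul, smul_eq_mul]
    have h2 : (a : ℂ) ^ (1 - s) * (a : ℂ) ^ s = a := by
      rw [← cpow_add _ _ ha0, show (1 : ℂ) - s + s = 1 by ring, cpow_one]
    calc _ = ((a⁻¹ : ℝ) : ℂ) * ((a : ℂ) ^ (1 - s) * (a : ℂ) ^ s) * K s := by ring
      _ = K s := by rw [h2, ofReal_inv, inv_mul_cancel₀ ha0, one_mul]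


/-! ## The converse half: right Mellin transforms of `L²(1,∞)` lie in `ℍ²` (Mellin–Plancherel)

For `φ ∈ L²(ℝ)` vanishing a.e. on `(−∞, 1]` the right Mellin transform `φ̂(s) = ∫₁^∞ φ(t)t^{−s}dt`
converges absolutely on `Re s > ½`, is holomorphic there (dominated holomorphic parameter integral,
`Literature.Analysis.Complex.differentiableOn_integral_of_dominated`), and on every vertical line
`∫‖φ̂(σ+iτ)‖²dτ = 2π∫₁^∞‖φ(t)‖²t^{1−2σ}dt ≤ 2π∫‖φ‖²` (Mellin–Plancherel,
`Literature.Analysis.FunctionSpaces.integral_norm_sq_mellin_eq`); so `φ̂ ∈ ℍ²` — the injectivity /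
isometry half of "`L²(1,∞;dt) ≅ ℍ²`" — and `φ` is determined a.e. by `φ̂` on `Re s > ½`. -/

namespace HardyRightPW

/-- For `φ ∈ L²` vanishing a.e. on `(−∞,1]` and `σ > ½`, `t ↦ ‖φ(t)‖t^{−σ}` is integrable on `(0,∞)`
(Cauchy–Schwarz on `(1,∞)`, where `t^{−2σ}` is integrable). [folklore] -/
private theorem integrableOn_norm_mul_rpow_neg {φ : ℝ → ℂ} (hφ : MemLp φ 2 volume)
    (hφ0 : ∀ᵐ t : ℝ, t ≤ 1 → φ t = 0) {σ : ℝ} (hσ : 1 / 2 < σ) :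
    IntegrableOn (fun t : ℝ ↦ ‖φ t‖ * t ^ (-σ)) (Ioi 0) := by
  have h1 : IntegrableOn (fun t : ℝ ↦ ‖φ t‖ * t ^ (-σ)) (Ioi 1) := by
    have hmeas : AEStronglyMeasurable (fun t : ℝ ↦ t ^ (-σ)) (volume.restrict (Ioi (1 : ℝ))) :=
      (measurable_id.pow_const (-σ)).aestronglyMeasurable
    have hg : MemLp (fun t : ℝ ↦ t ^ (-σ)) 2 (volume.restrict (Ioi (1 : ℝ))) := by
      refine (memLp_two_iff_integrable_sq hmeas).2 ?_
      have hi : IntegrableOn (fun t : ℝ ↦ t ^ (-(2 * σ))) (Ioi 1) :=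
        integrableOn_Ioi_rpow_of_lt (by linarith) one_pos
      refine hi.congr_fun (fun t ht ↦ ?_) measurableSet_Ioi
      have ht0 : 0 ≤ t := zero_le_one.trans (le_of_lt ht)
      rw [← Real.rpow_natCast, ← Real.rpow_mul ht0]
      push_cast
      ring_nf
    have hf : MemLp (fun t : ℝ ↦ ‖φ t‖) 2 (volume.restrict (Ioi (1 : ℝ))) := (hφ.restrict _).norm
    exact hf.integrable_mul hg
  have h2 : IntegrableOn (fun t : ℝ ↦ ‖φ t‖ * t ^ (-σ)) (Ioc 0 1) := by
    refine integrableOn_zero.congr_fun_ae ?_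
    filter_upwards [ae_restrict_mem (μ := (volume : Measure ℝ)) measurableSet_Ioc,
      ae_restrict_of_ae (s := Ioc (0 : ℝ) 1) hφ0] with t ht h0
    rw [h0 ht.2, norm_zero, zero_mul]
  rw [← Ioc_union_Ioi_eq_Ioi zero_le_one]
  exact h2.union h1

/-- For `φ ∈ L²` vanishing a.e. on `(−∞,1]` and `e ≤ 0`: `‖φ(t)‖² t^e ≤ ‖φ(t)‖²` a.e. on `(0,∞)` and
`t ↦ ‖φ(t)‖² t^e` is integrable on `(0,∞)`. [folklore] -/
private theorem integrableOn_norm_sq_mul_rpow {φ : ℝ → ℂ} (hφ : MemLp φ 2 volume)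
    (hφ0 : ∀ᵐ t : ℝ, t ≤ 1 → φ t = 0) {e : ℝ} (he : e ≤ 0) :
    (∀ᵐ t : ℝ ∂(volume.restrict (Ioi 0)), ‖φ t‖ ^ 2 * t ^ e ≤ ‖φ t‖ ^ 2) ∧
      IntegrableOn (fun t : ℝ ↦ ‖φ t‖ ^ 2 * t ^ e) (Ioi 0) := by
  have hφ2 : Integrable (fun t : ℝ ↦ ‖φ t‖ ^ 2) := (memLp_two_iff_integrable_sq_norm hφ.1).1 hφ
  have hle : ∀ᵐ t : ℝ ∂(volume.restrict (Ioi 0)), ‖φ t‖ ^ 2 * t ^ e ≤ ‖φ t‖ ^ 2 := by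
    filter_upwards [ae_restrict_mem (μ := (volume : Measure ℝ)) measurableSet_Ioi,
      ae_restrict_of_ae (s := Ioi (0 : ℝ)) hφ0] with t ht h0
    by_cases ht1 : t ≤ 1
    · rw [h0 ht1, norm_zero, zero_pow two_ne_zero, zero_mul]
    · exact mul_le_of_le_one_right (by positivity)
        (Real.rpow_le_one_of_one_le_of_nonpos (le_of_lt (not_le.1 ht1)) he)
  refine ⟨hle, ?_⟩
  refine Integrable.mono' (hφ2.integrableOn) ?_ ?_
  · exact ((hφ.1.norm.aemeasurable.pow_const 2).restrict.mul
      ((measurable_id.pow_const e).aemeasurable)).aestronglyMeasurable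
  · filter_upwards [hle, ae_restrict_mem (μ := (volume : Measure ℝ)) measurableSet_Ioi] with t ht ht0
    rw [Real.norm_eq_abs, abs_of_nonneg (mul_nonneg (by positivity) (Real.rpow_nonneg (le_of_lt ht0) _))]
    exact ht

end HardyRightPW

open HardyRightPW in
/-- RH-FREE. For `φ ∈ L²(ℝ)` vanishing a.e. on `(−∞, 1]`, the right Mellin transform
`φ̂(s) = ∫₀^∞ φ(t) t^{−s} dt` converges absolutely at every `s` with `Re s > ½`
(`∫₁^∞ ‖φ‖ t^{−Re s} dt ≤ ‖φ‖₂ (∫₁^∞ t^{−2 Re s} dt)^{1/2}`). [cite: Burnol2004b, §1 and §4 (arXiv:math/0203120v7 pp. 4, 7; TeX l.350–355, 633–636)] -/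
theorem mellinConvergent_one_sub_of_memLp {φ : ℝ → ℂ} (hφ : MemLp φ 2 volume)
    (hφ0 : ∀ᵐ t : ℝ, t ≤ 1 → φ t = 0) {s : ℂ} (hs : 1 / 2 < s.re) :
    MellinConvergent φ (1 - s) := by
  refine Integrable.mono' (integrableOn_norm_mul_rpow_neg hφ hφ0 hs) ?_ ?_
  · exact ((Complex.measurable_ofReal.pow_const _).aestronglyMeasurable).smul hφ.1.restrict
  · filter_upwards [ae_restrict_mem (μ := (volume : Measure ℝ)) measurableSet_Ioi] with t ht
    have hre : (1 - s - 1 : ℂ).re = -s.re := by rw [sub_re, sub_re, one_re]; ring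
    rw [norm_smul, norm_cpow_eq_rpow_re_of_pos ht, hre, mul_comm]

open HardyRightPW in
/-- RH-FREE. For `φ ∈ L²(ℝ)` vanishing a.e. on `(−∞, 1]`, the right Mellin transform `s ↦ φ̂(s)` is
holomorphic on the open half-plane `{Re s > ½}` (a dominated holomorphic parameter integral: on a
ball around `s₀` of radius `(Re s₀ − ½)/2` the integrand is dominated by `‖φ(t)‖ t^{−σ₁}`,
`σ₁ = (Re s₀ + ½)/2 … > ½`). [cite: Burnol2004b, §4 (arXiv:math/0203120v7 p. 7, TeX l.626–636)] -/
theorem differentiableOn_rightMellin_of_memLp {φ : ℝ → ℂ} (hφ : MemLp φ 2 volume)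
    (hφ0 : ∀ᵐ t : ℝ, t ≤ 1 → φ t = 0) :
    DifferentiableOn ℂ (rightMellin φ) {s : ℂ | 1 / 2 < s.re} := by
  show DifferentiableOn ℂ (fun s : ℂ ↦ ∫ t in Ioi (0 : ℝ), ((t : ℂ) ^ (1 - s - 1)) • φ t)
    {s : ℂ | 1 / 2 < s.re}
  refine Literature.Analysis.Complex.differentiableOn_integral_of_dominated
    (F := fun (s : ℂ) (t : ℝ) ↦ ((t : ℂ) ^ (1 - s - 1)) • φ t)
    (μ := (volume : Measure ℝ).restrict (Ioi 0)) (fun s _ ↦ ?_) ?_ (fun s₀ hs₀ ↦ ?_)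
  · exact ((Complex.measurable_ofReal.pow_const _).aestronglyMeasurable).smul hφ.1.restrict
  · filter_upwards [ae_restrict_mem (μ := (volume : Measure ℝ)) measurableSet_Ioi] with t ht
    intro s _
    refine DifferentiableAt.differentiableWithinAt ?_
    refine DifferentiableAt.smul_const ?_ (φ t)
    exact DifferentiableAt.const_cpow (by fun_prop) (Or.inl (ofReal_ne_zero.2 (ne_of_gt ht)))
  · simp only [mem_setOf_eq] at hs₀
    set R : ℝ := (s₀.re - 1 / 2) / 2 with hR
    have hR0 : 0 < R := by rw [hR]; linarith
    have hσ₁ : 1 / 2 < s₀.re - R := by rw [hR]; linarith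
    have hball : ∀ p ∈ Metric.ball s₀ R, s₀.re - R < p.re := by
      intro p hp
      rw [Metric.mem_ball, dist_eq_norm] at hp
      have h1 : |(p - s₀).re| ≤ ‖p - s₀‖ := abs_re_le_norm (p - s₀)
      rw [sub_re] at h1
      have h2 := (abs_lt.1 (lt_of_le_of_lt h1 hp)).1
      linarith
    refine ⟨R, hR0, fun p hp ↦ ?_, fun t ↦ ‖φ t‖ * t ^ (-(s₀.re - R)),
      integrableOn_norm_mul_rpow_neg hφ hφ0 hσ₁, ?_⟩
    · show 1 / 2 < p.re
      linarith [hball p hp]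
    · filter_upwards [ae_restrict_mem (μ := (volume : Measure ℝ)) measurableSet_Ioi,
        ae_restrict_of_ae (s := Ioi (0 : ℝ)) hφ0] with t ht h0
      intro p hp
      rw [norm_smul, norm_cpow_eq_rpow_re_of_pos ht]
      by_cases ht1 : t ≤ 1
      · rw [h0 ht1, norm_zero, mul_zero, zero_mul]
      · have hre : (1 - p - 1 : ℂ).re = -p.re := by rw [sub_re, sub_re, one_re]; ring
        rw [hre, mul_comm]
        refine mul_le_mul_of_nonneg_left ?_ (norm_nonneg _)
        exact Real.rpow_le_rpow_of_exponent_le (le_of_lt (not_le.1 ht1))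
          (by linarith [hball p hp])

open HardyRightPW in
/-- RH-FREE. **Mellin–Plancherel on vertical lines for `L²(1,∞)`**: for `φ ∈ L²(ℝ)` vanishing a.e. on
`(−∞, 1]` and `σ > ½`, `τ ↦ ‖φ̂(σ + iτ)‖²` is integrable and
`∫_ℝ ‖φ̂(σ + iτ)‖² dτ = 2π ∫₀^∞ ‖φ(t)‖² t^{1−2σ} dt` (Titchmarsh, *Fourier integrals*, Thm. 71, after
`s ↦ 1 − s`). [cite: Burnol2004b, §4 (arXiv:math/0203120v7 p. 7, TeX l.626–636)] -/
theorem integral_norm_sq_rightMellin_eq {φ : ℝ → ℂ} (hφ : MemLp φ 2 volume)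
    (hφ0 : ∀ᵐ t : ℝ, t ≤ 1 → φ t = 0) {σ : ℝ} (hσ : 1 / 2 < σ) :
    Integrable (fun τ : ℝ ↦ ‖rightMellin φ (σ + τ * I)‖ ^ 2) ∧
      ∫ τ : ℝ, ‖rightMellin φ (σ + τ * I)‖ ^ 2 =
        2 * π * ∫ t in Ioi (0 : ℝ), ‖φ t‖ ^ 2 * t ^ (1 - 2 * σ) := by
  have hpt : ∀ τ : ℝ, rightMellin φ (σ + τ * I) =
      mellin φ (((1 - σ : ℝ) : ℂ) + ((-τ : ℝ) : ℂ) * I) := by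
    intro τ
    show mellin φ (1 - (σ + τ * I)) = _
    congr 1
    push_cast
    ring
  have hconv : MellinConvergent φ ((1 - σ : ℝ) : ℂ) := by
    have h := mellinConvergent_one_sub_of_memLp hφ hφ0 (s := (σ : ℂ)) (by simpa using hσ)
    have e : (1 : ℂ) - (σ : ℂ) = ((1 - σ : ℝ) : ℂ) := by push_cast; ring
    rwa [e] at h
  have hf2 : IntegrableOn (fun t : ℝ ↦ ‖φ t‖ ^ 2 * t ^ (2 * (1 - σ) - 1)) (Ioi 0) :=
    (integrableOn_norm_sq_mul_rpow hφ hφ0 (e := 2 * (1 - σ) - 1) (by linarith)).2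
  obtain ⟨hi, heq⟩ := Literature.Analysis.FunctionSpaces.integral_norm_sq_mellin_eq hconv hf2
  have hfun : (fun τ : ℝ ↦ ‖rightMellin φ (σ + τ * I)‖ ^ 2) =
      fun τ ↦ (fun u : ℝ ↦ ‖mellin φ (((1 - σ : ℝ) : ℂ) + (u : ℂ) * I)‖ ^ 2) (-τ) := by
    funext τ
    simp only [hpt]
  refine ⟨by rw [hfun]; exact hi.comp_neg, ?_⟩
  rw [hfun]
  have hneg := integral_neg_eq_self
    (fun u : ℝ ↦ ‖mellin φ (((1 - σ : ℝ) : ℂ) + (u : ℂ) * I)‖ ^ 2) (volume : Measure ℝ)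
  refine (Eq.trans hneg heq).trans ?_
  congr 1
  refine setIntegral_congr_fun measurableSet_Ioi fun t _ ↦ ?_
  congr 1
  ring_nf

open HardyRightPW in
/-- RH-FREE. The vertical-line bound: for `φ ∈ L²(ℝ)` vanishing a.e. on `(−∞, 1]` and `σ > ½`,
`∫_ℝ ‖φ̂(σ + iτ)‖² dτ ≤ 2π ∫_ℝ ‖φ‖²` (since `t^{1−2σ} ≤ 1` on `t ≥ 1`), with equality in the limit
`σ ↓ ½` — the isometry of "`L²(1,∞;dt) ≅ ℍ²`" up to the factor `2π` of the tree's `|ds|/2π`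
normalisation. [cite: Burnol2004b, §4 (arXiv:math/0203120v7 p. 7, TeX l.626–636)] -/
theorem integral_norm_sq_rightMellin_le {φ : ℝ → ℂ} (hφ : MemLp φ 2 volume)
    (hφ0 : ∀ᵐ t : ℝ, t ≤ 1 → φ t = 0) {σ : ℝ} (hσ : 1 / 2 < σ) :
    ∫ τ : ℝ, ‖rightMellin φ (σ + τ * I)‖ ^ 2 ≤ 2 * π * ∫ t : ℝ, ‖φ t‖ ^ 2 := by
  rw [(integral_norm_sq_rightMellin_eq hφ hφ0 hσ).2]
  have hφ2 : Integrable (fun t : ℝ ↦ ‖φ t‖ ^ 2) := (memLp_two_iff_integrable_sq_norm hφ.1).1 hφ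
  obtain ⟨hle, hint⟩ := integrableOn_norm_sq_mul_rpow hφ hφ0 (e := 1 - 2 * σ) (by linarith)
  refine mul_le_mul_of_nonneg_left ?_ (by positivity)
  calc ∫ t in Ioi (0 : ℝ), ‖φ t‖ ^ 2 * t ^ (1 - 2 * σ)
      ≤ ∫ t in Ioi (0 : ℝ), ‖φ t‖ ^ 2 := integral_mono_ae hint hφ2.integrableOn hle
    _ ≤ ∫ t : ℝ, ‖φ t‖ ^ 2 := setIntegral_le_integral hφ2 (ae_of_all _ fun _ ↦ by positivity)

/-- RH-FREE. **`L²(1,∞; dt) → ℍ²`** (the injectivity/isometry half of Burnol's "the right Mellin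
transform is an isometric identification of `L²(1,∞;dt)` with `ℍ²`"): for `φ ∈ L²(ℝ)` vanishing
a.e. on `(−∞, 1]`, the right Mellin transform `φ̂` is in `ℍ² = H²(Re s > ½)` (`IsHardyRight`), with
the vertical-line constant `2π∫‖φ‖²`. [cite: Burnol2004b, §4 (arXiv:math/0203120v7 p. 7, TeX l.633–636)] -/
theorem isHardyRight_rightMellin_of_memLp {φ : ℝ → ℂ} (hφ : MemLp φ 2 volume)
    (hφ0 : ∀ᵐ t : ℝ, t ≤ 1 → φ t = 0) : IsHardyRight (rightMellin φ) := by
  refine ⟨differentiableOn_rightMellin_of_memLp hφ hφ0, 2 * π * ∫ t : ℝ, ‖φ t‖ ^ 2,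
    fun σ hσ ↦ ⟨?_, integral_norm_sq_rightMellin_le hφ hφ0 hσ⟩⟩
  have hcont : Continuous (fun τ : ℝ ↦ rightMellin φ (σ + τ * I)) := by
    refine (differentiableOn_rightMellin_of_memLp hφ hφ0).continuousOn.comp_continuous
      (by fun_prop) (fun τ ↦ ?_)
    show 1 / 2 < ((σ : ℂ) + (τ : ℂ) * I).re
    simpa using hσ
  exact (memLp_two_iff_integrable_sq_norm hcont.aestronglyMeasurable).2
    (integral_norm_sq_rightMellin_eq hφ hφ0 hσ).1

/-- RH-FREE. **`L²(a,∞; dt) → A^s ℍ²`, `A = 1/a`** (scaled form): for `a > 0` and `φ ∈ L²(ℝ)`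
vanishing a.e. on `(−∞, a]`, `s ↦ a^s φ̂(s)` is in `ℍ²` (it is the right Mellin transform of
`t ↦ a φ(at) ∈ L²(1,∞)`). [cite: Burnol2004b, §4 (arXiv:math/0203120v7 p. 7, TeX l.636–638)] -/
theorem isHardyRight_cpow_mul_rightMellin_of_memLp {φ : ℝ → ℂ} {a : ℝ} (ha : 0 < a)
    (hφ : MemLp φ 2 volume) (hφ0 : ∀ᵐ t : ℝ, t ≤ a → φ t = 0) :
    IsHardyRight (fun s ↦ (a : ℂ) ^ s * rightMellin φ s) := by
  have ha0 : (a : ℂ) ≠ 0 := ofReal_ne_zero.2 ha.ne'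
  -- `a^s φ̂(s)` is the right Mellin transform of `φ₁(t) = a φ(at)`
  have hfun : (fun s ↦ (a : ℂ) ^ s * rightMellin φ s) =
      rightMellin (fun t ↦ (a : ℂ) * φ (a * t)) := by
    funext s
    show (a : ℂ) ^ s * mellin φ (1 - s) = mellin (fun t ↦ (a : ℂ) • φ (a * t)) (1 - s)
    rw [mellin_const_smul, mellin_comp_mul_left _ _ ha, smul_eq_mul, smul_eq_mul, ← mul_assoc]
    congr 1
    rw [show (a : ℂ) * (a : ℂ) ^ (-(1 - s)) = (a : ℂ) ^ (1 : ℂ) * (a : ℂ) ^ (-(1 - s)) by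
      rw [cpow_one], ← cpow_add _ _ ha0]
    congr 1
    ring
  rw [hfun]
  have hqmp : Measure.QuasiMeasurePreserving (fun t : ℝ ↦ a * t) volume volume :=
    Measure.quasiMeasurePreserving_smul (μ := (volume : Measure ℝ)) ha.ne'
  have hφ₁ : MemLp (fun t ↦ (a : ℂ) * φ (a * t)) 2 volume := by
    have hmeas : AEStronglyMeasurable (fun t : ℝ ↦ φ (a * t)) volume :=
      hφ.1.comp_quasiMeasurePreserving hqmp
    have h1 : MemLp (fun t : ℝ ↦ φ (a * t)) 2 volume := by
      refine (memLp_two_iff_integrable_sq_norm hmeas).2 ?_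
      exact (((memLp_two_iff_integrable_sq_norm hφ.1).1 hφ).comp_mul_left' ha.ne' :)
    exact h1.const_mul _
  have hφ₁0 : ∀ᵐ t : ℝ, t ≤ 1 → (a : ℂ) * φ (a * t) = 0 := by
    filter_upwards [hqmp.ae hφ0] with t ht
    intro ht1
    have : a * t ≤ a := by nlinarith
    rw [ht this, mul_zero]
  exact isHardyRight_rightMellin_of_memLp hφ₁ hφ₁0


open HardyRightPW in
/-- RH-FREE. **Uniqueness** ("isometric identification": injectivity): an `L²(ℝ)` function vanishing
a.e. on `(−∞, 1]` is determined a.e. by its right Mellin transform on `{Re s > ½}` (by linearity and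
Mellin–Plancherel at `σ = 1`: `φ̂ ≡ 0` forces `∫₀^∞ ‖φ‖² t^{−1} dt = 0`).
[cite: Burnol2004b, §4 (arXiv:math/0203120v7 p. 7, TeX l.633–636)] -/
theorem ae_eq_of_rightMellin_eq {φ₁ φ₂ : ℝ → ℂ} (h₁ : MemLp φ₁ 2 volume) (h₂ : MemLp φ₂ 2 volume)
    (h₁0 : ∀ᵐ t : ℝ, t ≤ 1 → φ₁ t = 0) (h₂0 : ∀ᵐ t : ℝ, t ≤ 1 → φ₂ t = 0)
    (heq : ∀ s : ℂ, 1 / 2 < s.re → rightMellin φ₁ s = rightMellin φ₂ s) :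
    φ₁ =ᵐ[volume] φ₂ := by
  set φ : ℝ → ℂ := fun t ↦ φ₁ t - φ₂ t with hφdef
  have hφ : MemLp φ 2 volume := h₁.sub h₂
  have hφ0 : ∀ᵐ t : ℝ, t ≤ 1 → φ t = 0 := by
    filter_upwards [h₁0, h₂0] with t ha hb
    intro ht
    simp only [hφdef, ha ht, hb ht, sub_zero]
  -- `φ̂ = 0` on `Re s > ½`
  have hzero : ∀ s : ℂ, 1 / 2 < s.re → rightMellin φ s = 0 := by
    intro s hs
    have i₁ := mellinConvergent_one_sub_of_memLp h₁ h₁0 hs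
    have i₂ := mellinConvergent_one_sub_of_memLp h₂ h₂0 hs
    show ∫ t in Ioi (0 : ℝ), ((t : ℂ) ^ (1 - s - 1)) • φ t = 0
    have hsub : (fun t : ℝ ↦ ((t : ℂ) ^ (1 - s - 1)) • φ t) =
        fun t : ℝ ↦ ((t : ℂ) ^ (1 - s - 1)) • φ₁ t - ((t : ℂ) ^ (1 - s - 1)) • φ₂ t := by
      funext t
      simp only [hφdef, smul_sub]
    rw [hsub, integral_sub i₁ i₂]
    have e : mellin φ₁ (1 - s) = mellin φ₂ (1 - s) := heq s hs
    rw [mellin, mellin] at e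
    rw [e, sub_self]
  -- Mellin–Plancherel on the line `σ = 1`
  have hP := (integral_norm_sq_rightMellin_eq hφ hφ0 (σ := 1) (by norm_num)).2
  have hlhs : ∫ τ : ℝ, ‖rightMellin φ (1 + τ * I)‖ ^ 2 = 0 := by
    have h1 : ∀ τ : ℝ, rightMellin φ (1 + τ * I) = 0 := fun τ ↦ hzero _ (by simp; norm_num)
    simp [h1]
  have hint0 : ∫ t in Ioi (0 : ℝ), ‖φ t‖ ^ 2 * t ^ (1 - 2 * (1 : ℝ)) = 0 := by
    have h2π : (2 * π : ℝ) ≠ 0 := by positivity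
    have h := hP
    push_cast at h
    rw [hlhs] at h
    exact (mul_eq_zero.1 h.symm).resolve_left h2π
  obtain ⟨-, hi⟩ := integrableOn_norm_sq_mul_rpow hφ hφ0 (e := 1 - 2 * (1 : ℝ)) (by norm_num)
  have hnn : 0 ≤ᵐ[volume.restrict (Ioi (0 : ℝ))] fun t : ℝ ↦ ‖φ t‖ ^ 2 * t ^ (1 - 2 * (1 : ℝ)) := by
    filter_upwards [ae_restrict_mem (μ := (volume : Measure ℝ)) measurableSet_Ioi] with t ht
    exact mul_nonneg (by positivity) (Real.rpow_nonneg (le_of_lt ht) _)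
  have hae := (setIntegral_eq_zero_iff_of_nonneg_ae hnn hi).1 hint0
  -- conclude: `φ = 0` a.e. on `(0,∞)` by positivity of the weight, and on `(−∞,0]` by hypothesis
  have hpos : ∀ᵐ t : ℝ, t ∈ Ioi (0 : ℝ) → φ t = 0 := by
    rw [← ae_restrict_iff' measurableSet_Ioi]
    filter_upwards [hae, ae_restrict_mem (μ := (volume : Measure ℝ)) measurableSet_Ioi] with t ht ht0
    have ht' : ‖φ t‖ ^ 2 * t ^ (1 - 2 * (1 : ℝ)) = 0 := ht
    have hrpow : 0 < t ^ (1 - 2 * (1 : ℝ)) := Real.rpow_pos_of_pos ht0 _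
    have hn : ‖φ t‖ ^ 2 = 0 := (mul_eq_zero.1 ht').resolve_right hrpow.ne'
    exact norm_eq_zero.1 ((pow_eq_zero_iff two_ne_zero).1 hn)
  filter_upwards [hpos, hφ0] with t hp h0
  by_cases ht : 0 < t
  · exact sub_eq_zero.1 (hp ht)
  · exact sub_eq_zero.1 (h0 (le_trans (not_lt.1 ht) zero_le_one))

end Literature.NumberTheory.LFunctions
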